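import Mathlib
import Summits.Ventures.HodgeRepro2.T6N5TateTwist
import Summits.Ventures.HodgeRepro2.T6N5Hyp
import Summits.Ventures.HodgeRepro2.T6N5LocalDatum
import Summits.Ventures.HodgeRepro2.T6N5LocalHyp
import Summits.Ventures.HodgeRepro2.T6N5Local
import Summits.Ventures.HodgeRepro2.T6N5LocalCharDatum
import Summits.Ventures.HodgeRepro2.T6N5LocalInertHyp
import Summits.Ventures.HodgeRepro2.T6N5LocalRamHyp
import Summits.Ventures.HodgeRepro2.T6N5LocalInertCompletion
import Summits.Ventures.HodgeRepro2.T6N5LocalRamCompletion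
import Summits.Ventures.HodgeRepro2.T6N5LocalInertOnCompletion
import Summits.Ventures.HodgeRepro2.T6N5LocalRamOnCompletion
import Summits.Ventures.HodgeRepro2.T5LocalNormIndex

/-!
# T6N5LocalOnCompletionIndex — Tier 6, M2 sub-step N5 (t6-p8's half): the two assemblies with the norm-index
hypothesis DISCHARGED by p4's local norm index theorem

`T6N5LocalInertOnCompletion.N5Local_main_inert_completion` and `T6N5LocalRamOnCompletion.N5Local_main_ram_completion`
take `hind : [F_v^× : N E_v^×] = 2` as a hypothesis (it enters the datum through `η_v` = p4's `normChar`). p4's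
`T5LocalNormIndex.index_normGroup_eq_two` proves it at EVERY finite non-split place from `[L_w : K_v] = 2` and
`σ ≠ 1` alone (inert: the unit-index computation; ramified of any residue characteristic: the Herbrand-quotient
chain). The two corollaries below are the assemblies with `hind` replaced by that theorem: the datum is
`mkInert v w ϖ σ (index_normGroup_eq_two v w σ h2 hσ) T` resp. `mkRam v w hπ σ (index_normGroup_eq_two …) T`.
README §8(d): uses an L-value-free non-vanishing device: NO.
-/

namespace Summit.Ventures.HodgeRepro2.T6.N5LocalOnCompletionIndex

open Summit.Ventures.HodgeRepro2 IsDedekindDomain HeightOneSpectrum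
  Summit.Ventures.HodgeRepro2.T6.N5LocalDatum Summit.Ventures.HodgeRepro2.T6.N5LocalCharDatum
  Summit.Ventures.HodgeRepro2.T6.N5Local Summit.Ventures.HodgeRepro2.T6.Hyp
  Summit.Ventures.HodgeRepro2.T6.N5LocalInertCompletion Summit.Ventures.HodgeRepro2.T6.N5LocalRamCompletion
  Summit.Ventures.HodgeRepro2.T6.N5LocalInertOnCompletion Summit.Ventures.HodgeRepro2.T6.N5LocalRamOnCompletion

-- `K`, `L` in `Type` (universe `0`): `CharDatum.E : Type`.
variable {K : Type} [Field K] [NumberField K] (v : HeightOneSpectrum (NumberField.RingOfIntegers K))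
  {L : Type} [Field L] [NumberField L] [Algebra K L] (w : HeightOneSpectrum (NumberField.RingOfIntegers L))
  [w.asIdeal.LiesOver v.asIdeal]
  [ContinuousSMul (v.adicCompletion K) (w.adicCompletion L)]
  [IsScalarTower K (v.adicCompletion K) (w.adicCompletion L)]

/-- Theorem N5.T2 at an inert place on Mathlib's completions, with the norm index `[F_v^× : N E_v^×] = 2`
supplied by p4's `index_normGroup_eq_two` (from `[L_w : K_v] = 2` and `σ ≠ 1`). -/
theorem N5Local_main_inert_completion' {ϖ : v.adicCompletionIntegers K} (hϖ : Irreducible ϖ)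
    (hϖS : Irreducible (algebraMap (v.adicCompletionIntegers K) (w.adicCompletionIntegers L) ϖ))
    (hf : 2 ≤ (Ideal.span {ϖ}).inertiaDeg'
      (Ideal.span {algebraMap (v.adicCompletionIntegers K) (w.adicCompletionIntegers L) ϖ}))
    (h2 : Module.finrank (v.adicCompletion K) (w.adicCompletion L) = 2)
    (σ : Gal(w.adicCompletion L/v.adicCompletion K)) (hσ : σ ≠ 1) (T : TateSide (w.adicCompletion L)ˣ)
    (hG : GGP2012ex_Prop3_1 (mkInert v w ϖ σ (T5LocalNormIndex.index_normGroup_eq_two v w σ h2 hσ) T))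
    (hT : Tate1979_3_2_2_3 T.epsT (fun ξ a => ((ξ a : ℂˣ) : ℂ)) T.tw T.sc T.nrm (fun _ => True))
    (hc : (mkInert v w ϖ σ (T5LocalNormIndex.index_normGroup_eq_two v w σ h2 hσ) T).toCharDatum.Conventions)
    (hψδ : T.ψδ = T.tw T.ψ0 T.t) (ht : T.t ∈ Fsub v w)
    (hηt : ((ηF v w σ (T5LocalNormIndex.index_normGroup_eq_two v w σ h2 hσ) ⟨T.t, ht⟩ : ℂˣ) : ℂ) =
      (-1 : ℂ) ^ (T.d + 1))
    (hin : T.IsInert) (hψ0 : T.IsNormalised T.ψ0)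
    (h35 : BFGYYZ2025_Thm3_5
      (mkInert v w ϖ σ (T5LocalNormIndex.index_normGroup_eq_two v w σ h2 hσ) T).toLocalSignDatum)
    (hA1 : ∀ s : ℤˣ, ∃ α : (w.adicCompletion L)ˣ →* ℂˣ,
      (mkInert v w ϖ σ (T5LocalNormIndex.index_normGroup_eq_two v w σ h2 hσ) T).toLocalSignDatum.IsCO α ∧
        T.Theta s α)
    (hW : T.epsdW = 1)
    (hχW : (mkInert v w ϖ σ (T5LocalNormIndex.index_normGroup_eq_two v w σ h2 hσ) T).toLocalSignDatum.IsCS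
      T.χW) :
    ∃ ξ : Fin 4 → (w.adicCompletion L)ˣ →* ℂˣ,
      LocalSolution (mkInert v w ϖ σ (T5LocalNormIndex.index_normGroup_eq_two v w σ h2 hσ) T).toLocalSignDatum ξ :=
  N5Local_main_inert_completion v w hϖ hϖS hf h2 σ hσ _ T hG hT hc hψδ ht hηt hin hψ0 h35 hA1 hW hχW

/-- Theorem N5.T2 at a tame ramified place on Mathlib's completions, with the norm index supplied by p4's
`index_normGroup_eq_two`. -/
theorem N5Local_main_ram_completion' (h2 : Module.finrank (v.adicCompletion K) (w.adicCompletion L) = 2)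
    {ϖ : v.adicCompletionIntegers K} (hϖ : Irreducible ϖ) {π : w.adicCompletionIntegers L} (hπ : Irreducible π)
    (hram : ¬ Irreducible (algebraMap (v.adicCompletionIntegers K) (w.adicCompletionIntegers L) ϖ))
    (σ : Gal(w.adicCompletion L/v.adicCompletion K)) (hσ : σ ≠ 1) (h2u : IsUnit (2 : v.adicCompletionIntegers K))
    (T : TateSideRam (w.adicCompletion L)ˣ)
    (hT6 : Tate1979_3_2_6_3 (mkRam v w hπ σ (T5LocalNormIndex.index_normGroup_eq_two v w σ h2 hσ) T))
    (hG : GGP2012_Prop5_1_2 (mkRam v w hπ σ (T5LocalNormIndex.index_normGroup_eq_two v w σ h2 hσ) T))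
    (hω : (mkRam v w hπ σ (T5LocalNormIndex.index_normGroup_eq_two v w σ h2 hσ) T).IsUnramified
      (T.omega (1 / 2)))
    (hconj : T.IsConjInv T.ψδ)
    (h35 : BFGYYZ2025_Thm3_5
      (mkRam v w hπ σ (T5LocalNormIndex.index_normGroup_eq_two v w σ h2 hσ) T).toLocalSignDatum)
    (hA1 : ∀ s : ℤˣ, ∃ α : (w.adicCompletion L)ˣ →* ℂˣ,
      (mkRam v w hπ σ (T5LocalNormIndex.index_normGroup_eq_two v w σ h2 hσ) T).toLocalSignDatum.IsCO α ∧
        T.Theta s α)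
    (hW : T.epsdW = 1)
    (hχW : (mkRam v w hπ σ (T5LocalNormIndex.index_normGroup_eq_two v w σ h2 hσ) T).toLocalSignDatum.IsCS
      T.χW) :
    ∃ ξ : Fin 4 → (w.adicCompletion L)ˣ →* ℂˣ,
      LocalSolution (mkRam v w hπ σ (T5LocalNormIndex.index_normGroup_eq_two v w σ h2 hσ) T).toLocalSignDatum ξ :=
  N5Local_main_ram_completion v w h2 hϖ hπ hram σ hσ h2u _ T hT6 hG hω hconj h35 hA1 hW hχW

end Summit.Ventures.HodgeRepro2.T6.N5LocalOnCompletionIndex
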